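import Mathlib
import HarnessLib
import Summits.HubbardSuperconductivity.HubbardSuperconductivity.Theorems.KLProgrammeKLRegimeWickAbsConservation

/-!
# Route `KLProgramme` — ENGINE child (gen-6 `KLRegimeEngineV15`), stub `stub_engine_step_values`, (E2): the three channel sums of the two-line Wick
# term at the pair labels for an ARBITRARY SCALING-INVARIANT even vertex `W` (E2-WICK-ROADMAP §5 (iii-f); cell gate-hubbard-kl, seat p1 g9)

Re-keying of p500935 (`bubbleSum_pp_pairLabels`) and p502214 (`bubbleSum_phDirect/_phCrossed_pairLabels`) from the grid carrier `𝒲_n` to any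
`W : HubbardGrassmann L M` invariant under every non-zero vertex-compatible charge scaling (`hWinv`; selection rules `…WickAbsConservation`),
with the frequency-resolved pair kernel written out as `vertexFn L M β W 4 (…)` entries (for `W = 𝒲_n` these are `klWickPairKernel`, for the
continuous route's `W_Λ` they are k3c1-p1's `klws_pairKernelR`): `bubbleSumW_pp_pairLabels`, `bubbleSumW_phDirect_pairLabels`,
`bubbleSumW_phCrossed_pairLabels` — statements and proofs verbatim those of the `𝒲_n` versions.  Proved; no definitions.
-/

noncomputable section

namespace Summit.HubbardSuperconductivity.HubbardSuperconductivity.Theorems.KLRegimeWickAbs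

set_option linter.dupNamespace false -- summit = problem name (single-conjunct summit), D-0017

open Literature.MathematicalPhysics.QuantumLattice GrassmannAlgebra Finset Matrix
open Literature.Probability.LatticeModels
open Summit.HubbardSuperconductivity.HubbardSuperconductivity.Theorems.TwoPointAssembly
open Summit.HubbardSuperconductivity.HubbardSuperconductivity.Theorems.KLProgrammeLegKernels
open Summit.HubbardSuperconductivity.HubbardSuperconductivity.Theorems.KLRegimeSplit
open Summit.HubbardSuperconductivity.HubbardSuperconductivity.Theorems.KLRegimeWick

section Model

variable {L M : ℕ} [NeZero L] [NeZero M] (β : ℝ) {W : HubbardGrassmann L M}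
  (hWinv : ∀ φ : FreqMomentum L M × Fin 2 → ℂ, (∀ p, φ p ≠ 0) →
    (∀ k₁ k₂ k₃ k₄ : FreqMomentum L M,
      matsubaraInt M k₁.1 + matsubaraInt M k₃.1 = matsubaraInt M k₂.1 + matsubaraInt M k₄.1 ∧ k₁.2 + k₃.2 = k₂.2 + k₄.2 →
        φ (k₁, 0) * φ (k₃, 1) = φ (k₂, 0) * φ (k₄, 1)) →
    ExteriorAlgebra.map (LinearMap.mulLeft ℂ (scalingWeight φ)) W = W)
include hWinv

/-! ## §1 The particle–particle channel -/

/-- **`bubbleSum_pp_pairLabels`** — the particle–particle channel sum of `kernel_dblFold_bubble_self` at the pair labels, for diagonal lines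
`C₁, C₂` with values `ℓ₁, ℓ₂`:
`Σ_{X,Y,X',Y'} contr C₂ X Y · contr C₁ X' Y' · kernel 𝒲_n 4 (X, X', Q−k↓−, k↑−) · kernel 𝒲_n 4 (Y, Y', k′↑+, Q−k′↓+)
   = −c₄⁻²·Σ_{x=(p⃗,ω)} λ(x)·K_n(Q)((k⃗,ω₀),x)·K_n(Q)(x,(k⃗′,ω₀))`,
`λ(x) = ℓ₂(p)ℓ₁(p̄) + ℓ₁(p)ℓ₂(p̄)`, `p = (ω,p⃗)`, `p̄ = (−ω, Q−p⃗)`, `c₄ = 4!(βL²)³`.  Lines: `contr ℂ Cᵢ = diagContr ℓᵢ`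
(`contr_klSliceCov_eq_diagContr` etc.). -/
theorem bubbleSumW_pp_pairLabels (hβ : β ≠ 0) {C₁ C₂ : Matrix (HubbardFieldIdx L M) (HubbardFieldIdx L M) ℂ} {ℓ₁ ℓ₂ : FreqMomentum L M → ℂ}
    (h₁ : contr ℂ C₁ = diagContr L M ℓ₁) (h₂ : contr ℂ C₂ = diagContr L M ℓ₂) (Q k k' : TorusSite 2 L) :
    ∑ X, ∑ Y, ∑ X', ∑ Y', contr ℂ C₂ X Y * contr ℂ C₁ X' Y' *
        (kernel ℂ (W) 4 ![X, X', ((((omega0 M).rev, Q - k), 1), 1), (((omega0 M, k), 0), 1)] *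
          kernel ℂ (W) 4 ![Y, Y', (((omega0 M, k'), 0), 0), ((((omega0 M).rev, Q - k'), 1), 0)]) =
      -((((Nat.factorial 4 : ℝ) * (β * (L : ℝ) ^ 2) ^ 3 : ℝ) : ℂ)⁻¹ ^ 2 *
        ∑ x : TorusSite 2 L × MatsubaraIdx M,
          (ℓ₂ (x.2, x.1) * ℓ₁ (x.2.rev, Q - x.1) + ℓ₁ (x.2, x.1) * ℓ₂ (x.2.rev, Q - x.1)) *
            (vertexFn L M β W 4 ![(((x.2, x.1), 0), 0), (((x.2.rev, Q - x.1), 1), 0), ((((omega0 M).rev, Q - k), 1), 1), (((omega0 M, k), 0), 1)] *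
              vertexFn L M β W 4 ![(((omega0 M, k'), 0), 0), ((((omega0 M).rev, Q - k'), 1), 0), (((x.2.rev, Q - x.1), 1), 1), (((x.2, x.1), 0), 1)])) := by
  set c : ℂ := (((Nat.factorial 4 : ℝ) * (β * (L : ℝ) ^ 2) ^ 3 : ℝ) : ℂ) with hc
  set Z₂ : HubbardFieldIdx L M := ((((omega0 M).rev, Q - k), 1), 1) with hZ₂
  set Z₃ : HubbardFieldIdx L M := (((omega0 M, k), 0), 1) with hZ₃
  set Z₀ : HubbardFieldIdx L M := (((omega0 M, k'), 0), 0) with hZ₀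
  set Z₁ : HubbardFieldIdx L M := ((((omega0 M).rev, Q - k'), 1), 0) with hZ₁
  -- Step 1: both lines are reciprocal pairs read in both orientations
  rw [h₁, h₂]
  simp_rw [mul_assoc, ← Finset.mul_sum]
  rw [sum_diagContr_mul]
  simp_rw [sum_diagContr_mul]
  -- Step 2: charge conservation at the `a`-vertex (incoming legs `ψ̂⁻ψ̂⁻`): only `ψ̂⁺ψ̂⁺` line ends survive
  have hv1 : ∀ (p : FreqMomentum L M) (σ : Fin 2) (X' : HubbardFieldIdx L M), kernel ℂ W 4 ![((p, σ), 1), X', Z₂, Z₃] = 0 :=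
    fun p σ X' => kernel_pp_minus_left hWinv p σ X' _ _
  have hv2 : ∀ (X : HubbardFieldIdx L M) (p' : FreqMomentum L M) (σ' : Fin 2), kernel ℂ W 4 ![X, ((p', σ'), 1), Z₂, Z₃] = 0 :=
    fun X p' σ' => kernel_pp_minus_right hWinv X p' σ' _ _
  simp only [hv1, hv2, zero_mul, mul_zero, sub_zero, zero_sub, Finset.sum_neg_distrib, mul_neg]
  -- Step 3: momentum + frequency conservation: the second line sits at the pair partner `p̄`
  have hstep3 : ∀ (p : FreqMomentum L M) (σ : Fin 2),
      ∑ p' : FreqMomentum L M, ∑ σ' : Fin 2, ℓ₁ p' * (kernel ℂ W 4 ![((p, σ), 0), ((p', σ'), 0), Z₂, Z₃] *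
          kernel ℂ W 4 ![((p, σ), 1), ((p', σ'), 1), Z₀, Z₁]) =
        ∑ σ' : Fin 2, ℓ₁ (p.1.rev, Q - p.2) * (kernel ℂ W 4 ![((p, σ), 0), (((p.1.rev, Q - p.2), σ'), 0), Z₂, Z₃] *
          kernel ℂ W 4 ![((p, σ), 1), (((p.1.rev, Q - p.2), σ'), 1), Z₀, Z₁]) := by
    intro p σ
    refine Finset.sum_eq_single (p.1.rev, Q - p.2) (fun p' _ hp' => ?_) (fun h => absurd (Finset.mem_univ _) h)
    refine Finset.sum_eq_zero fun σ' _ => ?_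
    rw [kernel_pp_eq_zero_of_ne_partner hWinv Q k (omega0 M) p p' σ σ' hp', zero_mul, mul_zero]
  simp only [hstep3]
  -- Step 4: spin conservation: the internal pair carries opposite spins
  have hspin : ∀ (p : FreqMomentum L M) (σ : Fin 2),
      kernel ℂ W 4 ![((p, σ), 0), (((p.1.rev, Q - p.2), σ), 0), Z₂, Z₃] = 0 :=
    fun p σ => kernel_pp_eq_zero_of_spin_eq hWinv Q k (omega0 M) p _ σ
  simp only [Fin.sum_univ_two, hspin, zero_mul, mul_zero, zero_add, add_zero, Fin.isValue]
  simp only [Finset.sum_const_zero, zero_sub, neg_neg]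
  -- Step 5: the `(↓,↑)` assignment is the `(↑,↓)` one at the partner (involution + antisymmetry)
  rw [Finset.sum_add_distrib]
  have hre : ∑ p : FreqMomentum L M, ℓ₂ p * (ℓ₁ (p.1.rev, Q - p.2) *
        (kernel ℂ W 4 ![((p, 1), 0), (((p.1.rev, Q - p.2), 0), 0), Z₂, Z₃] * kernel ℂ W 4 ![((p, 1), 1), (((p.1.rev, Q - p.2), 0), 1), Z₀, Z₁])) =
      ∑ p : FreqMomentum L M, ℓ₂ (p.1.rev, Q - p.2) * (ℓ₁ p *
        (kernel ℂ W 4 ![((p, 0), 0), (((p.1.rev, Q - p.2), 1), 0), Z₂, Z₃] * kernel ℂ W 4 ![((p, 0), 1), (((p.1.rev, Q - p.2), 1), 1), Z₀, Z₁])) := by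
    refine Fintype.sum_bijective (fun p : FreqMomentum L M => ((p.1.rev, Q - p.2) : FreqMomentum L M)) (pairPartner_involutive Q).bijective
      _ _ (fun p => ?_)
    simp only [Fin.rev_rev, sub_sub_cancel, Prod.mk.eta]
    rw [kernel_four_swap01 W ((p, 1), 0), kernel_four_swap01 W ((p, 1), 1)]
    ring
  rw [hre, ← Finset.sum_add_distrib]
  -- Step 6: read the two surviving kernels as entries of the frequency-resolved pair kernel
  rw [← Equiv.sum_comp (Equiv.prodComm (MatsubaraIdx M) (TorusSite 2 L)), Finset.mul_sum, ← Finset.sum_neg_distrib]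
  refine Finset.sum_congr rfl fun p _ => ?_
  simp only [Equiv.prodComm_apply, Prod.swap, Prod.mk.eta]
  rw [kernel_four_cycle W Z₀ Z₁ (((p.1.rev, Q - p.2), 1), 1) ((p, 0), 1), kernel_four_eq_inv_mul_vertexFn β hβ W,
    kernel_four_eq_inv_mul_vertexFn β hβ W]
  ring


/-! ## §2 The direct particle–hole channel at the pair labels -/

/-- **`bubbleSum_phDirect_pairLabels`** — the direct particle–hole channel sum of `kernel_dblFold_bubble_self` at the pair labels (`a`-legs
`Z₀ = k′↑+`, `Z₃ = k↑−`; `b`-legs `Z₁ = Q−k′↓+`, `Z₂ = Q−k↓−`), for diagonal lines: ONE loop sum over `(p, σ)`, the second line at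
`p + t`, `t = (0, k − k′)` (same frequency, same spin),
`= −c₄⁻²·Σ_{p,σ} (ℓ₂(p)ℓ₁(p+t) + ℓ₁(p)ℓ₂(p+t))·𝒱₄(𝒲_n)(ψ̂⁻_{pσ}, ψ̂⁺_{p+t,σ}, Z₀, Z₃)·𝒱₄(𝒲_n)(ψ̂⁺_{pσ}, ψ̂⁻_{p+t,σ}, Z₁, Z₂)`. -/
theorem bubbleSumW_phDirect_pairLabels (hβ : β ≠ 0) {C₁ C₂ : Matrix (HubbardFieldIdx L M) (HubbardFieldIdx L M) ℂ}
    {ℓ₁ ℓ₂ : FreqMomentum L M → ℂ} (h₁ : contr ℂ C₁ = diagContr L M ℓ₁) (h₂ : contr ℂ C₂ = diagContr L M ℓ₂) (Q k k' : TorusSite 2 L) :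
    ∑ X, ∑ Y, ∑ X', ∑ Y', contr ℂ C₂ X Y * contr ℂ C₁ X' Y' *
        (kernel ℂ (W) 4 ![X, X', (((omega0 M, k'), 0), 0), (((omega0 M, k), 0), 1)] *
          kernel ℂ (W) 4 ![Y, Y', ((((omega0 M).rev, Q - k'), 1), 0), ((((omega0 M).rev, Q - k), 1), 1)]) =
      -((((Nat.factorial 4 : ℝ) * (β * (L : ℝ) ^ 2) ^ 3 : ℝ) : ℂ)⁻¹ ^ 2 *
        ∑ p : FreqMomentum L M, ∑ σ : Fin 2,
          (ℓ₂ p * ℓ₁ (p.1, p.2 + k - k') + ℓ₁ p * ℓ₂ (p.1, p.2 + k - k')) *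
            (vertexFn L M β (W) 4
                ![((p, σ), 1), (((p.1, p.2 + k - k'), σ), 0), (((omega0 M, k'), 0), 0), (((omega0 M, k), 0), 1)] *
              vertexFn L M β (W) 4
                ![((p, σ), 0), (((p.1, p.2 + k - k'), σ), 1), ((((omega0 M).rev, Q - k'), 1), 0), ((((omega0 M).rev, Q - k), 1), 1)])) := by
  set Z₀ : HubbardFieldIdx L M := (((omega0 M, k'), 0), 0) with hZ₀
  set Z₃ : HubbardFieldIdx L M := (((omega0 M, k), 0), 1) with hZ₃
  set Z₁ : HubbardFieldIdx L M := ((((omega0 M).rev, Q - k'), 1), 0) with hZ₁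
  set Z₂ : HubbardFieldIdx L M := ((((omega0 M).rev, Q - k), 1), 1) with hZ₂
  -- Step 1: line reductions
  rw [h₁, h₂]
  simp_rw [mul_assoc, ← Finset.mul_sum]
  rw [sum_diagContr_mul]
  simp_rw [sum_diagContr_mul]
  -- Step 2: charge conservation at the `a`-vertex (legs `ψ̂⁺ψ̂⁻`): equal-charge line ends die
  have hv : ∀ (p p' : FreqMomentum L M) (σ σ' c : Fin 2), kernel ℂ W 4 ![((p, σ), c), ((p', σ'), c), Z₀, Z₃] = 0 :=
    fun p p' σ σ' c => kernel_ph_same_charge hWinv p p' σ σ' c _ _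
  simp only [hv, zero_mul, sub_zero, zero_sub, mul_neg, Finset.sum_neg_distrib, Finset.mul_sum]
  -- Step 3: the two orientation terms merge (exchange the summation pairs, antisymmetry twice)
  have hB : ∑ p : FreqMomentum L M, ∑ σ : Fin 2, ∑ p' : FreqMomentum L M, ∑ σ' : Fin 2, ℓ₂ p * (ℓ₁ p' *
        (kernel ℂ W 4 ![((p, σ), 0), ((p', σ'), 1), Z₀, Z₃] * kernel ℂ W 4 ![((p, σ), 1), ((p', σ'), 0), Z₁, Z₂])) =
      ∑ p : FreqMomentum L M, ∑ σ : Fin 2, ∑ p' : FreqMomentum L M, ∑ σ' : Fin 2, ℓ₂ p' * (ℓ₁ p *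
        (kernel ℂ W 4 ![((p, σ), 1), ((p', σ'), 0), Z₀, Z₃] * kernel ℂ W 4 ![((p, σ), 0), ((p', σ'), 1), Z₁, Z₂])) := by
    rw [sum_swap_pairs]
    refine Finset.sum_congr rfl fun p _ => Finset.sum_congr rfl fun σ _ => Finset.sum_congr rfl fun p' _ =>
      Finset.sum_congr rfl fun σ' _ => ?_
    rw [kernel_four_swap01 W ((p, σ), 1) ((p', σ'), 0), kernel_four_swap01 W ((p, σ), 0) ((p', σ'), 1)]
    ring
  -- Step 4: conservation at the `a`-vertex fixes `(p′, σ′) = (p + t, σ)`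
  have hcons : ∀ (p : FreqMomentum L M) (σ : Fin 2) (g : FreqMomentum L M → FreqMomentum L M → ℂ),
      ∑ p' : FreqMomentum L M, ∑ σ' : Fin 2, g p p' *
        (kernel ℂ W 4 ![((p, σ), 1), ((p', σ'), 0), Z₀, Z₃] * kernel ℂ W 4 ![((p, σ), 0), ((p', σ'), 1), Z₁, Z₂]) =
      g p (p.1, p.2 + k - k') * (kernel ℂ W 4 ![((p, σ), 1), (((p.1, p.2 + k - k'), σ), 0), Z₀, Z₃] *
        kernel ℂ W 4 ![((p, σ), 0), (((p.1, p.2 + k - k'), σ), 1), Z₁, Z₂]) := by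
    intro p σ g
    rw [← Fintype.sum_prod_type']
    refine Finset.sum_eq_single (((p.1, p.2 + k - k'), σ) : FreqMomentum L M × Fin 2) (fun q _ hq => ?_)
      (fun h => absurd (Finset.mem_univ _) h)
    obtain ⟨p', σ'⟩ := q
    dsimp only
    rw [kernel_phd_eq_zero_of_ne hWinv k k' (omega0 M) p p' σ σ' hq, zero_mul, mul_zero]
  have hmerge : ∀ (p : FreqMomentum L M) (σ : Fin 2),
      -(∑ p' : FreqMomentum L M, ∑ σ' : Fin 2, ℓ₂ p * (ℓ₁ p' *
          (kernel ℂ W 4 ![((p, σ), 1), ((p', σ'), 0), Z₀, Z₃] * kernel ℂ W 4 ![((p, σ), 0), ((p', σ'), 1), Z₁, Z₂]))) -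
        ∑ p' : FreqMomentum L M, ∑ σ' : Fin 2, ℓ₂ p' * (ℓ₁ p *
          (kernel ℂ W 4 ![((p, σ), 1), ((p', σ'), 0), Z₀, Z₃] * kernel ℂ W 4 ![((p, σ), 0), ((p', σ'), 1), Z₁, Z₂])) =
      -((ℓ₂ p * ℓ₁ (p.1, p.2 + k - k') + ℓ₁ p * ℓ₂ (p.1, p.2 + k - k')) *
        (kernel ℂ W 4 ![((p, σ), 1), (((p.1, p.2 + k - k'), σ), 0), Z₀, Z₃] *
          kernel ℂ W 4 ![((p, σ), 0), (((p.1, p.2 + k - k'), σ), 1), Z₁, Z₂])) := by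
    intro p σ
    rw [← neg_add', ← Finset.sum_add_distrib, ← hcons p σ (fun p p' => ℓ₂ p * ℓ₁ p' + ℓ₁ p * ℓ₂ p')]
    congr 1
    refine Finset.sum_congr rfl fun p' _ => ?_
    rw [← Finset.sum_add_distrib]
    refine Finset.sum_congr rfl fun σ' _ => ?_
    ring
  -- assemble
  have hL : ∑ p : FreqMomentum L M, ∑ σ : Fin 2, ℓ₂ p *
        (-(∑ p' : FreqMomentum L M, ∑ σ' : Fin 2, ℓ₁ p' *
            (kernel ℂ W 4 ![((p, σ), 1), ((p', σ'), 0), Z₀, Z₃] * kernel ℂ W 4 ![((p, σ), 0), ((p', σ'), 1), Z₁, Z₂])) -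
          ∑ p' : FreqMomentum L M, ∑ σ' : Fin 2, ℓ₁ p' *
            (kernel ℂ W 4 ![((p, σ), 0), ((p', σ'), 1), Z₀, Z₃] * kernel ℂ W 4 ![((p, σ), 1), ((p', σ'), 0), Z₁, Z₂])) =
      ∑ p : FreqMomentum L M, ∑ σ : Fin 2,
        (-(∑ p' : FreqMomentum L M, ∑ σ' : Fin 2, ℓ₂ p * (ℓ₁ p' *
            (kernel ℂ W 4 ![((p, σ), 1), ((p', σ'), 0), Z₀, Z₃] * kernel ℂ W 4 ![((p, σ), 0), ((p', σ'), 1), Z₁, Z₂]))) -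
          ∑ p' : FreqMomentum L M, ∑ σ' : Fin 2, ℓ₂ p * (ℓ₁ p' *
            (kernel ℂ W 4 ![((p, σ), 0), ((p', σ'), 1), Z₀, Z₃] * kernel ℂ W 4 ![((p, σ), 1), ((p', σ'), 0), Z₁, Z₂]))) := by
    refine Finset.sum_congr rfl fun p _ => Finset.sum_congr rfl fun σ _ => ?_
    rw [mul_sub, mul_neg, Finset.mul_sum, Finset.mul_sum]
    simp only [Finset.mul_sum]
  have hsplit : ∑ p : FreqMomentum L M, ∑ σ : Fin 2,
        (-(∑ p' : FreqMomentum L M, ∑ σ' : Fin 2, ℓ₂ p * (ℓ₁ p' *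
            (kernel ℂ W 4 ![((p, σ), 1), ((p', σ'), 0), Z₀, Z₃] * kernel ℂ W 4 ![((p, σ), 0), ((p', σ'), 1), Z₁, Z₂]))) -
          ∑ p' : FreqMomentum L M, ∑ σ' : Fin 2, ℓ₂ p * (ℓ₁ p' *
            (kernel ℂ W 4 ![((p, σ), 0), ((p', σ'), 1), Z₀, Z₃] * kernel ℂ W 4 ![((p, σ), 1), ((p', σ'), 0), Z₁, Z₂]))) =
      -(∑ p : FreqMomentum L M, ∑ σ : Fin 2, ∑ p' : FreqMomentum L M, ∑ σ' : Fin 2, ℓ₂ p * (ℓ₁ p' *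
            (kernel ℂ W 4 ![((p, σ), 1), ((p', σ'), 0), Z₀, Z₃] * kernel ℂ W 4 ![((p, σ), 0), ((p', σ'), 1), Z₁, Z₂]))) -
        ∑ p : FreqMomentum L M, ∑ σ : Fin 2, ∑ p' : FreqMomentum L M, ∑ σ' : Fin 2, ℓ₂ p * (ℓ₁ p' *
            (kernel ℂ W 4 ![((p, σ), 0), ((p', σ'), 1), Z₀, Z₃] * kernel ℂ W 4 ![((p, σ), 1), ((p', σ'), 0), Z₁, Z₂])) := by
    rw [← neg_add', ← Finset.sum_add_distrib, ← Finset.sum_neg_distrib]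
    refine Finset.sum_congr rfl fun p _ => ?_
    rw [← Finset.sum_add_distrib, ← Finset.sum_neg_distrib]
    refine Finset.sum_congr rfl fun σ _ => ?_
    rw [neg_add']
  rw [hL, hsplit, hB]
  conv_rhs => rw [← Finset.sum_neg_distrib]
  rw [← Finset.sum_neg_distrib, ← Finset.sum_sub_distrib]
  refine Finset.sum_congr rfl fun p _ => ?_
  conv_rhs => rw [← Finset.sum_neg_distrib]
  rw [← Finset.sum_neg_distrib, ← Finset.sum_sub_distrib]
  refine Finset.sum_congr rfl fun σ _ => ?_
  rw [hmerge p σ, kernel_four_eq_inv_mul_vertexFn β hβ W, kernel_four_eq_inv_mul_vertexFn β hβ W]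
  ring

/-! ## §3 The crossed particle–hole channel at the pair labels -/

/-- **`bubbleSum_phCrossed_pairLabels`** — the crossed particle–hole channel sum of `kernel_dblFold_bubble_self` at the pair labels (`a`-legs
`Z₀ = k′↑+`, `Z₂ = Q−k↓−`; `b`-legs `Z₁ = Q−k′↓+`, `Z₃ = k↑−`), for diagonal lines: ONE loop sum over `p` (spin `↑` on the `ψ̂⁻_{p}` end forced),
the second line at `p′ = (ω_p − 2ω₀, p⃗ + Q − k − k′)` with spin `↓` — written as the sum over `p′` restricted by the conservation condition
`n(ω_{p′}) + 1 = n(ω_p) ∧ p⃗′ = p⃗ + Q − k − k′` (empty at the lowest frequency index: the finite-`M` edge):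
`= −c₄⁻²·Σ_p Σ_{p′} [cond]·(ℓ₂(p)ℓ₁(p′) + ℓ₁(p)ℓ₂(p′))·𝒱₄(𝒲_n)(ψ̂⁻_{p↑}, ψ̂⁺_{p′↓}, Z₀, Z₂)·𝒱₄(𝒲_n)(ψ̂⁺_{p↑}, ψ̂⁻_{p′↓}, Z₁, Z₃)`
— the exchange bubble at transfer `k + k′ − Q` (E2-DRIVE's Kohn–Luttinger source). -/
theorem bubbleSumW_phCrossed_pairLabels (hβ : β ≠ 0) {C₁ C₂ : Matrix (HubbardFieldIdx L M) (HubbardFieldIdx L M) ℂ}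
    {ℓ₁ ℓ₂ : FreqMomentum L M → ℂ} (h₁ : contr ℂ C₁ = diagContr L M ℓ₁) (h₂ : contr ℂ C₂ = diagContr L M ℓ₂) (Q k k' : TorusSite 2 L) :
    ∑ X, ∑ Y, ∑ X', ∑ Y', contr ℂ C₂ X Y * contr ℂ C₁ X' Y' *
        (kernel ℂ (W) 4 ![X, X', (((omega0 M, k'), 0), 0), ((((omega0 M).rev, Q - k), 1), 1)] *
          kernel ℂ (W) 4 ![Y, Y', ((((omega0 M).rev, Q - k'), 1), 0), (((omega0 M, k), 0), 1)]) =
      -((((Nat.factorial 4 : ℝ) * (β * (L : ℝ) ^ 2) ^ 3 : ℝ) : ℂ)⁻¹ ^ 2 *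
        ∑ p : FreqMomentum L M, ∑ p' : FreqMomentum L M,
          if matsubaraInt M p'.1 + 1 = matsubaraInt M p.1 ∧ p'.2 = p.2 + Q - k - k' then
            (ℓ₂ p * ℓ₁ p' + ℓ₁ p * ℓ₂ p') *
              (vertexFn L M β (W) 4
                  ![((p, 0), 1), ((p', 1), 0), (((omega0 M, k'), 0), 0), ((((omega0 M).rev, Q - k), 1), 1)] *
                vertexFn L M β (W) 4
                  ![((p, 0), 0), ((p', 1), 1), ((((omega0 M).rev, Q - k'), 1), 0), (((omega0 M, k), 0), 1)])
          else 0) := by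
  set Z₀ : HubbardFieldIdx L M := (((omega0 M, k'), 0), 0) with hZ₀
  set Z₂ : HubbardFieldIdx L M := ((((omega0 M).rev, Q - k), 1), 1) with hZ₂
  set Z₁ : HubbardFieldIdx L M := ((((omega0 M).rev, Q - k'), 1), 0) with hZ₁
  set Z₃ : HubbardFieldIdx L M := (((omega0 M, k), 0), 1) with hZ₃
  -- Step 1: line reductions
  rw [h₁, h₂]
  simp_rw [mul_assoc, ← Finset.mul_sum]
  rw [sum_diagContr_mul]
  simp_rw [sum_diagContr_mul]
  -- Step 2: charge conservation at the `a`-vertex (legs `ψ̂⁺ψ̂⁻`)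
  have hv : ∀ (p p' : FreqMomentum L M) (σ σ' c : Fin 2), kernel ℂ W 4 ![((p, σ), c), ((p', σ'), c), Z₀, Z₂] = 0 :=
    fun p p' σ σ' c => kernel_ph_same_charge hWinv p p' σ σ' c _ _
  simp only [hv, zero_mul, sub_zero, zero_sub, mul_neg, Finset.sum_neg_distrib, Finset.mul_sum]
  -- Step 3: merge the two orientation terms
  have hB : ∑ p : FreqMomentum L M, ∑ σ : Fin 2, ∑ p' : FreqMomentum L M, ∑ σ' : Fin 2, ℓ₂ p * (ℓ₁ p' *
        (kernel ℂ W 4 ![((p, σ), 0), ((p', σ'), 1), Z₀, Z₂] * kernel ℂ W 4 ![((p, σ), 1), ((p', σ'), 0), Z₁, Z₃])) =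
      ∑ p : FreqMomentum L M, ∑ σ : Fin 2, ∑ p' : FreqMomentum L M, ∑ σ' : Fin 2, ℓ₂ p' * (ℓ₁ p *
        (kernel ℂ W 4 ![((p, σ), 1), ((p', σ'), 0), Z₀, Z₂] * kernel ℂ W 4 ![((p, σ), 0), ((p', σ'), 1), Z₁, Z₃])) := by
    rw [sum_swap_pairs]
    refine Finset.sum_congr rfl fun p _ => Finset.sum_congr rfl fun σ _ => Finset.sum_congr rfl fun p' _ =>
      Finset.sum_congr rfl fun σ' _ => ?_
    rw [kernel_four_swap01 W ((p, σ), 1) ((p', σ'), 0), kernel_four_swap01 W ((p, σ), 0) ((p', σ'), 1)]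
    ring
  -- Step 4: conservation at the `a`-vertex: spins `(↑, ↓)`, frequency lowered by one, momentum shifted by `Q − k − k′`
  have hcons : ∀ (p : FreqMomentum L M) (g : FreqMomentum L M → FreqMomentum L M → ℂ),
      ∑ σ : Fin 2, ∑ p' : FreqMomentum L M, ∑ σ' : Fin 2, g p p' *
        (kernel ℂ W 4 ![((p, σ), 1), ((p', σ'), 0), Z₀, Z₂] * kernel ℂ W 4 ![((p, σ), 0), ((p', σ'), 1), Z₁, Z₃]) =
      ∑ p' : FreqMomentum L M, if matsubaraInt M p'.1 + 1 = matsubaraInt M p.1 ∧ p'.2 = p.2 + Q - k - k' then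
        g p p' * (kernel ℂ W 4 ![((p, 0), 1), ((p', 1), 0), Z₀, Z₂] * kernel ℂ W 4 ![((p, 0), 0), ((p', 1), 1), Z₁, Z₃]) else 0 := by
    intro p g
    have hz : ∀ (p' : FreqMomentum L M) (σ σ' : Fin 2),
        ¬(matsubaraInt M p'.1 + 1 = matsubaraInt M p.1 ∧ p'.2 = p.2 + Q - k - k' ∧ σ = 0 ∧ σ' = 1) →
          kernel ℂ W 4 ![((p, σ), 1), ((p', σ'), 0), Z₀, Z₂] = 0 :=
      fun p' σ σ' h => kernel_phx_eq_zero_of_not hWinv Q k k' p p' σ σ' h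
    rw [Finset.sum_comm]
    refine Finset.sum_congr rfl fun p' _ => ?_
    simp only [Fin.sum_univ_two, Fin.isValue]
    rw [hz p' 0 0 (by simp), hz p' 1 0 (by simp), hz p' 1 1 (by simp)]
    by_cases hc : matsubaraInt M p'.1 + 1 = matsubaraInt M p.1 ∧ p'.2 = p.2 + Q - k - k'
    · rw [if_pos hc]; ring
    · rw [if_neg hc, hz p' 0 1 (fun h => hc ⟨h.1, h.2.1⟩)]; ring
  have hmerge : ∀ p : FreqMomentum L M,
      ∑ σ : Fin 2, (-(∑ p' : FreqMomentum L M, ∑ σ' : Fin 2, ℓ₂ p * (ℓ₁ p' *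
          (kernel ℂ W 4 ![((p, σ), 1), ((p', σ'), 0), Z₀, Z₂] * kernel ℂ W 4 ![((p, σ), 0), ((p', σ'), 1), Z₁, Z₃]))) -
        ∑ p' : FreqMomentum L M, ∑ σ' : Fin 2, ℓ₂ p' * (ℓ₁ p *
          (kernel ℂ W 4 ![((p, σ), 1), ((p', σ'), 0), Z₀, Z₂] * kernel ℂ W 4 ![((p, σ), 0), ((p', σ'), 1), Z₁, Z₃]))) =
      -(∑ p' : FreqMomentum L M, if matsubaraInt M p'.1 + 1 = matsubaraInt M p.1 ∧ p'.2 = p.2 + Q - k - k' then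
        (ℓ₂ p * ℓ₁ p' + ℓ₁ p * ℓ₂ p') *
          (kernel ℂ W 4 ![((p, 0), 1), ((p', 1), 0), Z₀, Z₂] * kernel ℂ W 4 ![((p, 0), 0), ((p', 1), 1), Z₁, Z₃]) else 0) := by
    intro p
    rw [← hcons p (fun p p' => ℓ₂ p * ℓ₁ p' + ℓ₁ p * ℓ₂ p'), ← Finset.sum_neg_distrib]
    refine Finset.sum_congr rfl fun σ _ => ?_
    rw [← neg_add', ← Finset.sum_add_distrib]
    congr 1
    refine Finset.sum_congr rfl fun p' _ => ?_
    rw [← Finset.sum_add_distrib]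
    refine Finset.sum_congr rfl fun σ' _ => ?_
    ring
  -- assemble
  have hL : ∑ p : FreqMomentum L M, ∑ σ : Fin 2, ℓ₂ p *
        (-(∑ p' : FreqMomentum L M, ∑ σ' : Fin 2, ℓ₁ p' *
            (kernel ℂ W 4 ![((p, σ), 1), ((p', σ'), 0), Z₀, Z₂] * kernel ℂ W 4 ![((p, σ), 0), ((p', σ'), 1), Z₁, Z₃])) -
          ∑ p' : FreqMomentum L M, ∑ σ' : Fin 2, ℓ₁ p' *
            (kernel ℂ W 4 ![((p, σ), 0), ((p', σ'), 1), Z₀, Z₂] * kernel ℂ W 4 ![((p, σ), 1), ((p', σ'), 0), Z₁, Z₃])) =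
      -(∑ p : FreqMomentum L M, ∑ σ : Fin 2, ∑ p' : FreqMomentum L M, ∑ σ' : Fin 2, ℓ₂ p * (ℓ₁ p' *
            (kernel ℂ W 4 ![((p, σ), 1), ((p', σ'), 0), Z₀, Z₂] * kernel ℂ W 4 ![((p, σ), 0), ((p', σ'), 1), Z₁, Z₃]))) -
        ∑ p : FreqMomentum L M, ∑ σ : Fin 2, ∑ p' : FreqMomentum L M, ∑ σ' : Fin 2, ℓ₂ p * (ℓ₁ p' *
            (kernel ℂ W 4 ![((p, σ), 0), ((p', σ'), 1), Z₀, Z₂] * kernel ℂ W 4 ![((p, σ), 1), ((p', σ'), 0), Z₁, Z₃])) := by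
    rw [← neg_add', ← Finset.sum_add_distrib, ← Finset.sum_neg_distrib]
    refine Finset.sum_congr rfl fun p _ => ?_
    rw [← Finset.sum_add_distrib, ← Finset.sum_neg_distrib]
    refine Finset.sum_congr rfl fun σ _ => ?_
    rw [neg_add', mul_sub, mul_neg, Finset.mul_sum, Finset.mul_sum]
    simp only [Finset.mul_sum]
  rw [hL, hB]
  conv_rhs => rw [← Finset.sum_neg_distrib]
  rw [← Finset.sum_neg_distrib, ← Finset.sum_sub_distrib]
  refine Finset.sum_congr rfl fun p _ => ?_
  rw [← Finset.sum_neg_distrib, ← Finset.sum_sub_distrib, hmerge p, neg_inj]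
  refine Finset.sum_congr rfl fun p' _ => ?_
  split_ifs
  · rw [kernel_four_eq_inv_mul_vertexFn β hβ W, kernel_four_eq_inv_mul_vertexFn β hβ W]
    ring
  · ring

end Model

end Summit.HubbardSuperconductivity.HubbardSuperconductivity.Theorems.KLRegimeWickAbs

end
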